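import Summits.QuantumFields.BalabanUV.T4Continuum.Support.KingPairingPlantedLaw
import Summits.QuantumFields.BalabanUV.T4Continuum.Spine.BackgroundResolventLaw

/-!
# T⁴ programme, spine node NE2 (U1a) — BLOCK PAIRING GEOMETRY: how King's pairing `J_R = R^{d/2}Q_Rᴴ` intertwines fine and
# coarse TRANSLATIONS, DIFFERENCES and MULTIPLICATION OPERATORS (exact identities on the torus, position space)

Ninth generation of the NE2 prover lineage P1 of the cell `pub-balaban`, file 6 (the position-space toolkit for the first
DERIVATIVE-type instance of `Spine/BackgroundResolventTower.PerturbationLaws`, file 7 `Support/FirstOrderBackgroundModel`).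
Everything here is exact finite combinatorics of the `R`-blocks of `T_{η/R}` over `T_η` ([King1986] (2.10) «B^k(y)») — no
estimate, no printed statement:

 * §1 `parT` (block parent on `site × component`), `tau` (unit translation of an index), `faceF μ` (the diagonal indicator of
   the FAR `μ`-FACE of each block: sites `x′` with `R ∣ x′_μ + 1`, no separate predicate); `JK_apply` (`(J_R)_{x′y} = R^{−d/2}·[y = par x′]`);
   **`par_add_unitVec`**: `par(x′ + e_μ) = par x′ + e_μ` on the far face and `= par x′` off it.
 * §2 THE INTERTWINERS: **`shift_sub_one_mul_JK`** `(S′_μ − 1)J_R = F_μ·J_R·(S_μ − 1)` (a fine unit step moves a block-constant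
   field only across the far face), hence **`fdiff_mul_JK`** `∇′_μJ_R = R·F_μJ_R∇_μ`; **`JK_mul_diagonal`** `J_R·diag V =
   diag(V ∘ par)·J_R`; **`shiftM_mul_diagonal`** / **`fdiff_mul_diagonal`** (discrete LEIBNIZ rule `∇_μ·diag V = diag(V∘τ_μ)∇_μ +
   c·diag(V∘τ_μ − V)`); `conjTranspose_shiftM_mul` (`S_μᴴS_μ = 1`), `fdiff_eq_neg_conjTranspose` (`∇ = −(∇ᴴ)·S` for real `c`).
 * (companion file `Support/BlockPairingFaces`: the one COUNT `J_RᴴF_μJ_R = R⁻¹·1`, `Π·(R·F_μ − 1)·J_R = 0`, and the norms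
   `‖F_μ‖ ≤ 1`, `‖R·F_μ − 1‖ ≤ R + 1`, `‖𝒢∇_μ‖ ≤ Cst`.)

HONEST FRAMING (T4-DAG p. 1).  [folklore] lattice bookkeeping, OURS; `U = 1` objects only; nothing printed is a hypothesis; NOT
infinite volume / mass gap / Clay / summit progress; spine 0/9 unchanged.  HONEST DEPENDENCY: continuum YM on T⁴ ⇐ BetaPertH ∧ nine
spine estimates (0/9 proved); BetaPertH ⇐ (D1) ∧ (D4) ∧ CAP+tail; G-an2-4 gates asym, D1 and NE2/3/4.  ABSOLUTE RULE kept; no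
`sorry`.
-/

noncomputable section

open scoped BigOperators ComplexConjugate Matrix Matrix.Norms.L2Operator

namespace Summit.QuantumFields.BalabanUV.T4Continuum.BlockPairingGeometry

open Literature.MathematicalPhysics.QuantumFieldTheory.Balaban1983to89.B5Prop11Plancherel
open Literature.MathematicalPhysics.QuantumFieldTheory.Balaban1983to89.B5G183RateTorus (cpt)
open Literature.MathematicalPhysics.QuantumFieldTheory.Balaban1983to89.B5G183RateTorusW
open Summit.QuantumFields.BalabanUV.T4Continuum.BalabanAveragedTowerModes (par rem val_par cpt_par_add_off_rem par_cpt_add_off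
  rem_cpt_add_off eq_par_rem_of_eq)
open Summit.QuantumFields.BalabanUV.T4Continuum.BalabanBlockPoincare (Pi transl transl_mul_apply transl_eq_iff opNorm_transl_le
  shiftM_eq_transl Qavg_conjTranspose_mul_apply)
open Summit.QuantumFields.BalabanUV.T4Continuum.KingPairingPlantedLaw

variable {d : ℕ}

/-! ## §1 Parents, translations, faces -/

section OneLevel

variable (Nf : Fin d → ℕ) [hNf : ∀ μ, NeZero (Nf μ)]

/-- unit translation of an index in direction `μ`: `τ_μ(x, ν) = (x + e_μ, ν)`. [folklore] -/
def tau (μ : Fin d) (i : Tor Nf × Fin d) : Tor Nf × Fin d := (i.1 + unitVec Nf μ, i.2)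

/-- `S_μ · diag V = diag(V ∘ τ_μ) · S_μ`. [folklore] -/
theorem shiftM_mul_diagonal (μ : Fin d) (V : Tor Nf × Fin d → ℂ) :
    shiftM Nf μ * Matrix.diagonal V = Matrix.diagonal (V ∘ tau Nf μ) * shiftM Nf μ := by
  ext i j
  rw [Matrix.mul_diagonal, Matrix.diagonal_mul]
  simp only [shiftM, Function.comp_apply, tau]
  by_cases h : j = (i.1 + unitVec Nf μ, i.2)
  · rw [if_pos h, h, one_mul, mul_one]
  · rw [if_neg h, zero_mul, mul_zero]

/-- **DISCRETE LEIBNIZ RULE**: `∇^c_μ · diag V = diag(V ∘ τ_μ)·∇^c_μ + c·(diag(V ∘ τ_μ) − diag V)`. [cite: Balaban1984PropagatorsI, (1.31)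
p.23] [folklore] -/
theorem fdiff_mul_diagonal (c : ℂ) (μ : Fin d) (V : Tor Nf × Fin d → ℂ) :
    fdiff Nf c μ * Matrix.diagonal V
      = Matrix.diagonal (V ∘ tau Nf μ) * fdiff Nf c μ + c • (Matrix.diagonal (V ∘ tau Nf μ) - Matrix.diagonal V) := by
  simp only [fdiff, Matrix.smul_mul, Matrix.mul_smul, Matrix.sub_mul, Matrix.mul_sub, Matrix.one_mul, Matrix.mul_one,
    shiftM_mul_diagonal, smul_sub]
  abel

omit hNf in
/-- `T_vᴴ = T_{−v}`. [folklore] -/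
theorem conjTranspose_transl (v : Tor Nf) : (transl Nf v)ᴴ = transl Nf (-v) := by
  ext i j
  rw [Matrix.conjTranspose_apply]
  simp only [transl]
  have e : (i = (j.1 + v, j.2)) ↔ (j = (i.1 + -v, i.2)) := by
    rw [transl_eq_iff Nf v j i, sub_eq_add_neg]
  by_cases h : i = (j.1 + v, j.2)
  · rw [if_pos h, if_pos (e.mp h), star_one]
  · rw [if_neg h, if_neg (fun hh => h (e.mpr hh)), star_zero]

/-- `S_μᴴ S_μ = 1` (translations are unitary). [folklore] -/
theorem conjTranspose_shiftM_mul (μ : Fin d) : (shiftM Nf μ)ᴴ * shiftM Nf μ = 1 := by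
  rw [shiftM_eq_transl, conjTranspose_transl, ← BalabanBlockPoincare.transl_add, neg_add_cancel, BalabanBlockPoincare.transl_zero]

/-- `‖S_μ‖ ≤ 1`. [folklore] -/
theorem opNorm_shiftM_le (μ : Fin d) : ‖shiftM Nf μ‖ ≤ 1 := by
  rw [shiftM_eq_transl]; exact opNorm_transl_le Nf _

/-- for a REAL lattice factor `c`: `∇^c_μ = −(∇^c_μ)ᴴ·S_μ` (`S − 1 = −(Sᴴ − 1)S`). [folklore] -/
theorem fdiff_eq_neg_conjTranspose_mul (c : ℝ) (μ : Fin d) :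
    fdiff Nf (c : ℂ) μ = -((fdiff Nf (c : ℂ) μ)ᴴ * shiftM Nf μ) := by
  rw [fdiff, Matrix.conjTranspose_smul, Complex.star_def, Complex.conj_ofReal, Matrix.conjTranspose_sub, Matrix.conjTranspose_one,
    Matrix.smul_mul, Matrix.sub_mul, conjTranspose_shiftM_mul, Matrix.one_mul, ← smul_neg, neg_sub]

/-- `‖diag V‖ ≤ α` from pointwise bounds `‖V i‖ ≤ α` (`α ≥ 0`). [folklore] -/
theorem opNorm_diagonal_le {V : Tor Nf × Fin d → ℂ} {α : ℝ} (hα : 0 ≤ α) (hV : ∀ i, ‖V i‖ ≤ α) :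
    ‖Matrix.diagonal V‖ ≤ α := by
  rw [Matrix.l2_opNorm_diagonal]
  exact (pi_norm_le_iff_of_nonneg hα).mpr hV

end OneLevel

/-! ## §2 Two levels: King's pairing against translations, differences and multiplications -/

section TwoLevel

variable (N R : ℕ) [NeZero N] [NeZero R] (M : Fin d → ℕ) [hM : ∀ μ, NeZero (M μ)]

/-- the block parent on indices: `parT(x′, ν) = (par x′, ν)`. [cite: King1986, (2.10) p.653] [folklore] -/
def parT (i : Tor (fine (R * N) M) × Fin d) : Tor (fine N M) × Fin d := (par N R M i.1, i.2)

/-- the diagonal indicator `F_μ` of the FAR `μ`-FACE of the blocks: fine sites `x′` whose `μ`-offset is `R − 1`, i.e.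
`R ∣ x′_μ + 1`. [folklore] -/
def faceF (μ : Fin d) : Matrix (Tor (fine (R * N) M) × Fin d) (Tor (fine (R * N) M) × Fin d) ℂ :=
  Matrix.diagonal fun i => if R ∣ (i.1 μ).val + 1 then 1 else 0

/-- **the entries of King's pairing**: `(J_R)_{x′, y} = √(R^d)·R^{−d}·[parT x′ = y]`. [cite: King1986, p.664, (2.10) p.653] [folklore] -/
theorem JK_apply (x : Tor (fine (R * N) M) × Fin d) (y : Tor (fine N M) × Fin d) :
    JK N R M x y = (((Real.sqrt ((R : ℝ) ^ d)) : ℝ) : ℂ) * (((R : ℂ) ^ d)⁻¹ * if parT N R M x = y then 1 else 0) := by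
  have h := Qavg_conjTranspose_mul_apply N R M (1 : Matrix (Tor (fine N M) × Fin d) (Tor (fine N M) × Fin d) ℂ) x y
  rw [Matrix.mul_one] at h
  rw [JK, Matrix.smul_apply, smul_eq_mul, h, Matrix.one_apply, parT]

/-- the face is decided by the offset: `face(R·y + j) ↔ R ∣ j_μ + 1`. [folklore] -/
theorem face_cpt_add_off_iff (μ : Fin d) (y : Tor (fine N M)) (j : Fin d → Fin R) :
    R ∣ ((cpt N R M y + off N R M j) μ).val + 1 ↔ R ∣ (j μ : ℕ) + 1 := by
  have h := rem_cpt_add_off N R M y j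
  have hv : ((cpt N R M y + off N R M j) μ).val % R = (j μ : ℕ) := by
    have := congrArg (fun f => ((f μ : Fin R) : ℕ)) h
    simpa [rem] using this
  rw [Nat.dvd_iff_mod_eq_zero, Nat.dvd_iff_mod_eq_zero, Nat.add_mod, hv]
  conv_rhs => rw [Nat.add_mod, Nat.mod_eq_of_lt (j μ).isLt]

/-- **THE PARENT OF A SHIFTED SITE**: `par(x′ + e_μ) = par x′ + e_μ` if `x′` lies on the far `μ`-face of its block, `= par x′`
otherwise (with the torus wrap-around in both lattices). [cite: King1986, (2.10) p.653] [folklore] -/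
theorem par_add_unitVec (μ : Fin d) (x : Tor (fine (R * N) M)) :
    par N R M (x + unitVec (fine (R * N) M) μ)
      = if R ∣ (x μ).val + 1 then par N R M x + unitVec (fine N M) μ else par N R M x := by
  have hR : 0 < R := Nat.pos_of_ne_zero (NeZero.ne R)
  have hNM : 0 < N * M μ := Nat.pos_of_ne_zero (NeZero.ne _)
  set v := (x μ).val with hv
  have hvlt : v < R * N * M μ := ZMod.val_lt (x μ)
  -- components `ν ≠ μ` are untouched on both sides
  have hoff : ∀ ν, ν ≠ μ → (x + unitVec (fine (R * N) M) μ) ν = x ν := by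
    intro ν hν; simp [unitVec, hν]
  have hoff' : ∀ ν, ν ≠ μ → (par N R M x + unitVec (fine N M) μ) ν = par N R M x ν := by
    intro ν hν; simp [unitVec, hν]
  -- the `μ` component
  have hμ : (x + unitVec (fine (R * N) M) μ) μ = x μ + 1 := by simp [unitVec]
  funext ν
  by_cases hν : ν = μ
  · subst hν
    split_ifs with hf
    · -- far face: `R ∣ v + 1`
      show (par N R M (x + unitVec (fine (R * N) M) ν)) ν = (par N R M x + unitVec (fine N M) ν) ν
      have e2 : (par N R M x + unitVec (fine N M) ν) ν = (((v / R + 1 : ℕ)) : ZMod (fine N M ν)) := by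
        simp only [Pi.add_apply, unitVec, Pi.single_eq_same, par, Nat.cast_add, Nat.cast_one, ← hv]
      rw [e2]
      unfold par
      rw [hμ]
      obtain ⟨q, hq⟩ := hf
      by_cases hwrap : v + 1 < R * N * M ν
      · have hval : (x ν + 1).val = v + 1 := by
          rw [ZMod.val_add, ZMod.val_one_eq_one_mod, ← hv]
          rw [Nat.add_mod, Nat.mod_mod, ← Nat.add_mod, Nat.mod_eq_of_lt hwrap]
        rw [hval, hq, Nat.mul_div_cancel_left q hR]
        have : v / R + 1 = q := by
          have h1 : v + 1 = R * q := hq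
          have h2 : v = R * q - 1 := by omega
          have hq0 : 0 < q := by
            rcases Nat.eq_zero_or_pos q with h | h
            · rw [h, mul_zero] at h1; omega
            · exact h
          rw [h2]
          have h3 : R * q - 1 = R * (q - 1) + (R - 1) := by
            rcases q with _ | q
            · omega
            · simp [Nat.mul_succ]; omega
          rw [h3, Nat.mul_add_div hR, Nat.div_eq_of_lt (Nat.sub_lt hR one_pos), add_zero]
          omega
        rw [this]
      · -- wrap-around: `v + 1 = R·N·M_ν`, both sides are `0`
        have heq : v + 1 = R * N * M ν := by omega
        have hzero : x ν + 1 = 0 := by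
          have h1 : ((v : ℕ) : ZMod (fine (R * N) M ν)) = x ν := by rw [hv, ZMod.natCast_zmod_val]
          rw [← h1, ← Nat.cast_one, ← Nat.cast_add, heq]
          exact ZMod.natCast_self _
        rw [hzero, ZMod.val_zero, Nat.zero_div, Nat.cast_zero]
        have hq' : v / R + 1 = N * M ν := by
          have h1 : R * q = R * (N * M ν) := by rw [← hq, heq, mul_assoc]
          have hqq : q = N * M ν := Nat.eq_of_mul_eq_mul_left hR h1
          have h2 : v = R * (N * M ν) - 1 := by rw [← hqq, ← hq]; omega
          rw [h2]
          have h3 : R * (N * M ν) - 1 = R * (N * M ν - 1) + (R - 1) := by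
            obtain ⟨m, hm⟩ : ∃ m, N * M ν = m + 1 := ⟨N * M ν - 1, by omega⟩
            rw [hm]; simp [Nat.mul_succ]; omega
          rw [h3, Nat.mul_add_div hR, Nat.div_eq_of_lt (Nat.sub_lt hR one_pos), add_zero]
          omega
        rw [hq']
        exact (ZMod.natCast_self _).symm
    · -- off the face: no carry
      show (par N R M (x + unitVec (fine (R * N) M) ν)) ν = par N R M x ν
      unfold par
      rw [hμ]
      have hmod : (v + 1) % R ≠ 0 := fun h0 => hf (Nat.dvd_of_mod_eq_zero h0)
      have hwrap : v + 1 < R * N * M ν := by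
        rcases Nat.lt_or_ge (v + 1) (R * N * M ν) with h | h
        · exact h
        · exfalso
          have heq : v + 1 = R * N * M ν := by omega
          apply hmod
          rw [heq, mul_assoc, Nat.mul_mod_right]
      have hval : (x ν + 1).val = v + 1 := by
        rw [ZMod.val_add, ZMod.val_one_eq_one_mod, ← hv]
        rw [Nat.add_mod, Nat.mod_mod, ← Nat.add_mod, Nat.mod_eq_of_lt hwrap]
      rw [hval, Nat.succ_div, if_neg hf, add_zero, ← hv]
  · have lhs : par N R M (x + unitVec (fine (R * N) M) μ) ν = par N R M x ν := by
      unfold par; rw [hoff ν hν]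
    rw [lhs]
    split_ifs with hf
    · exact (hoff' ν hν).symm
    · rfl

/-- **`(S′_μ − 1)·J_R = F_μ·J_R·(S_μ − 1)`**: a unit step on the finer lattice changes a block-constant field only on the far
`μ`-face, where it sees the next block. [cite: King1986, (2.10) p.653] [folklore] -/
theorem shift_sub_one_mul_JK (μ : Fin d) :
    (shiftM (fine (R * N) M) μ - 1) * JK N R M = faceF N R M μ * JK N R M * (shiftM (fine N M) μ - 1) := by
  ext x y
  have eL : (((shiftM (fine (R * N) M) μ - 1) * JK N R M : Matrix _ _ ℂ) x y)
      = JK N R M (x.1 + unitVec (fine (R * N) M) μ, x.2) y - JK N R M x y := by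
    rw [Matrix.sub_mul, Matrix.one_mul, Matrix.sub_apply, shiftM_eq_transl, transl_mul_apply]
  have hS : ((JK N R M * shiftM (fine N M) μ : Matrix _ _ ℂ) x y) = JK N R M x (y.1 - unitVec (fine N M) μ, y.2) := by
    rw [Matrix.mul_apply, Finset.sum_eq_single (y.1 - unitVec (fine N M) μ, y.2)]
    · simp only [shiftM]
      rw [if_pos ((transl_eq_iff (fine N M) (unitVec (fine N M) μ) (y.1 - unitVec (fine N M) μ, y.2) y).mpr rfl), mul_one]
    · intro z _ hz
      simp only [shiftM]
      rw [if_neg (fun h => hz ((transl_eq_iff (fine N M) (unitVec (fine N M) μ) z y).mp h)), mul_zero]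
    · intro h; exact absurd (Finset.mem_univ _) h
  have eR : ((faceF N R M μ * JK N R M * (shiftM (fine N M) μ - 1) : Matrix _ _ ℂ) x y)
      = (if R ∣ (x.1 μ).val + 1 then 1 else 0) * (JK N R M x (y.1 - unitVec (fine N M) μ, y.2) - JK N R M x y) := by
    rw [Matrix.mul_assoc, faceF, Matrix.diagonal_mul, Matrix.mul_sub, Matrix.mul_one, Matrix.sub_apply, hS]
  rw [eL, eR, JK_apply, JK_apply, JK_apply]
  simp only [parT]
  have c2 : ((par N R M x.1, x.2) = (y.1 - unitVec (fine N M) μ, y.2)) ↔ ((par N R M x.1 + unitVec (fine N M) μ, x.2) = y) := by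
    constructor
    · intro h
      have h1 := (Prod.ext_iff.mp h).1
      have h2 := (Prod.ext_iff.mp h).2
      exact Prod.ext (by simp only at h1 ⊢; rw [h1, sub_add_cancel]) h2
    · intro h
      rw [← h]
      simp
  simp only [c2]
  have hpar := par_add_unitVec N R M μ x.1
  by_cases hf : R ∣ (x.1 μ).val + 1
  · rw [if_pos hf] at hpar
    simp only [hpar, if_pos hf, one_mul]
  · rw [if_neg hf] at hpar
    simp only [hpar, if_neg hf, zero_mul]
    exact sub_self _

/-- **`∇′_μ J_R = R·F_μ J_R ∇_μ`** (`∇′ = (RN)(S′ − 1)`, `∇ = N(S − 1)`). [cite: Balaban1984PropagatorsI, (1.31) p.23; King1986,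
(2.10) p.653] [folklore] -/
theorem fdiff_mul_JK (hN : 1 ≤ N) (μ : Fin d) :
    fdiff (fine (R * N) M) (((R * N : ℕ)) : ℂ) μ * JK N R M
      = ((R : ℂ)) • (faceF N R M μ * JK N R M * fdiff (fine N M) ((N : ℕ) : ℂ) μ) := by
  have hNc : ((N : ℕ) : ℂ) ≠ 0 := by exact_mod_cast (Nat.pos_iff_ne_zero.mp hN)
  rw [fdiff, fdiff, Matrix.smul_mul, shift_sub_one_mul_JK, Matrix.mul_smul, smul_smul]
  push_cast
  rfl

/-- **`J_R·diag V = diag(V ∘ parT)·J_R`**: multiplying a coarse field by `V` and extending piecewise-constantly is multiplying the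
extension by `V ∘ par`. [folklore] -/
theorem JK_mul_diagonal (V : Tor (fine N M) × Fin d → ℂ) :
    JK N R M * Matrix.diagonal V = Matrix.diagonal (V ∘ parT N R M) * JK N R M := by
  ext x y
  rw [Matrix.mul_diagonal, Matrix.diagonal_mul, JK_apply, Function.comp_apply]
  by_cases h : parT N R M x = y
  · rw [if_pos h, h]; ring
  · rw [if_neg h]; ring

/-- `diag(V ∘ parT)` commutes with the block-mean projector `Π = J_RJ_Rᴴ`. [folklore] -/
theorem Pi_mul_diagonal_comp (V : Tor (fine N M) × Fin d → ℂ) :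
    Pi N R M * Matrix.diagonal (V ∘ parT N R M) = Matrix.diagonal (V ∘ parT N R M) * Pi N R M := by
  have h1 := JK_mul_diagonal N R M V
  have h2 : (JK N R M)ᴴ * Matrix.diagonal (V ∘ parT N R M) = Matrix.diagonal V * (JK N R M)ᴴ := by
    have := congrArg Matrix.conjTranspose (JK_mul_diagonal N R M (star V))
    rw [Matrix.conjTranspose_mul, Matrix.conjTranspose_mul, Matrix.diagonal_conjTranspose, Matrix.diagonal_conjTranspose,
      star_star] at this
    have e : star (star V ∘ parT N R M) = V ∘ parT N R M := by funext i; simp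
    rw [e] at this
    exact this.symm
  rw [← JK_mul_conjTranspose, Matrix.mul_assoc, h2, ← Matrix.mul_assoc, h1, Matrix.mul_assoc]

end TwoLevel

end Summit.QuantumFields.BalabanUV.T4Continuum.BlockPairingGeometry

end
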